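import Summits.Ventures.PercRepro.RankLevelSetH
import Summits.Ventures.PercRepro.PlaneStepThree

/-!
# PercRepro — C-025 Theorem O, Step 2 in the spelling of `C025`: `(5, 3)` on every simple matroid with
`ρ(E) ≥ 5`, coloop-free when `ρ(E) = 5` (p2, gen 5)

`PlaneStepThree.lean` proves `(5/4)·#U′ ≤ #Y` on finsets (`ThmO.five_quarter_mul_card_U_le'`).  Here it is restated
with the set-builders of `C025` at `(p, q) = (5, 3)` (`phiK 5 3 = 5/4`): **`c025_five_three_of_simple`**.  The
`|E|`-induction wrapper (loops, parallel pairs via Theorem F + `c025_of_q_two` at `p = 4`, the coloop step of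
§16 Step 0) is `TheoremOAll.lean`.
-/

namespace PercRepro

open Finset

namespace ThmO

open ThmH

variable {α : Type*} [DecidableEq α] {M : Matroid α} [M.Finite]

/-- `Φ(5, 3) = 5/4`. -/
theorem phiK_five_three : phiK 5 3 = 5 / 4 := by
  unfold phiK
  rw [show Finset.Ioo 3 5 = {4} from by decide, Finset.sum_singleton,
    show Nat.choose 8 4 = 70 by decide, show Nat.choose 8 5 = 56 by decide]
  norm_num

/-- The `U(5, 3)` set-builder of `C025` is at most `#U′` (complementation `A ↦ E ∖ A`). -/
theorem ncard_U53_le_card_U (M : Matroid α) [M.Finite] :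
    {A : Set α | A ⊆ M.E ∧ M.eRk A = ((5 : ℕ) : ℕ∞) ∧ M.eRk (M.E \ A) = ((3 : ℕ) : ℕ∞)}.ncard ≤ (U M).card := by
  rw [ncard_family_eq_card M (fun A => M.eRk A = ((5 : ℕ) : ℕ∞) ∧ M.eRk (M.E \ A) = ((3 : ℕ) : ℕ∞))]
  refine Finset.card_le_card_of_injOn (fun A => gr M \ A) ?_ ?_
  · intro A hA
    simp only [Finset.mem_coe, Finset.mem_filter, Finset.mem_powerset] at hA
    obtain ⟨hAE, hA5, hA3⟩ := hA
    simp only [Finset.mem_coe, U, Finset.mem_filter, Finset.mem_powerset]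
    refine ⟨Finset.sdiff_subset, ?_, ?_⟩
    · rw [Finset.coe_sdiff, coe_gr, hA3]; rfl
    · rw [Finset.sdiff_sdiff_eq_self hAE, hA5]; rfl
  · intro A hA A' hA' h
    simp only [Finset.mem_coe, Finset.mem_filter, Finset.mem_powerset] at hA hA'
    simp only at h
    rw [← Finset.sdiff_sdiff_eq_self hA.1, ← Finset.sdiff_sdiff_eq_self hA'.1, h]

omit [DecidableEq α] in
/-- The `Y(5, 3)` set-builder of `C025` counts the rank-4 sets `Y M`. -/
theorem ncard_Y53_eq_card_Y (M : Matroid α) [M.Finite] :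
    {A : Set α | A ⊆ M.E ∧ ((3 : ℕ) : ℕ∞) < M.eRk A ∧ M.eRk A < ((5 : ℕ) : ℕ∞)}.ncard = (Y M).card := by
  rw [ncard_family_eq_card M (fun A => ((3 : ℕ) : ℕ∞) < M.eRk A ∧ M.eRk A < ((5 : ℕ) : ℕ∞))]
  unfold Y
  congr 1
  apply Finset.filter_congr
  intro B _
  obtain ⟨k, hk, -⟩ := eRk_eq_nat M B
  rw [hk]
  constructor
  · rintro ⟨h1, h2⟩
    have h1' : 3 < k := by exact_mod_cast h1
    have h2' : k < 5 := by exact_mod_cast h2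
    have : k = 4 := by omega
    rw [this]; rfl
  · intro h
    have h' : k = 4 := by exact_mod_cast h
    subst h'
    exact ⟨by norm_num, by norm_num⟩

end ThmO

open ThmO ThmH in
/-- **C-025 at `(5, 3)` on every simple matroid with `ρ(E) ≥ 5`, coloop-free when `ρ(E) = 5`** (mine-2 Theorem O,
`MINE2-RLS.md` §16 Steps 1–3): `phiK 5 3 · #{A ⊆ E : ρ(A) = 5, ρ(E ∖ A) = 3} ≤ #{A ⊆ E : 3 < ρ(A) < 5}`. -/
theorem c025_five_three_of_simple {α : Type*} (M : Matroid α) [M.Finite]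
    (hs : ∀ e ∈ M.E, ∀ f ∈ M.E, e ≠ f → M.eRk {e, f} = 2) (hpE : (5 : ℕ∞) ≤ M.eRank)
    (hcol : M.eRank = 5 → ∀ e, ¬ M.IsColoop e) :
    phiK 5 3 * ({A : Set α | A ⊆ M.E ∧ M.eRk A = ((5 : ℕ) : ℕ∞) ∧ M.eRk (M.E \ A) = ((3 : ℕ) : ℕ∞)}.ncard : ℚ) ≤
      ({A : Set α | A ⊆ M.E ∧ ((3 : ℕ) : ℕ∞) < M.eRk A ∧ M.eRk A < ((5 : ℕ) : ℕ∞)}.ncard : ℚ) := by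
  classical
  rw [ncard_Y53_eq_card_Y, phiK_five_three]
  have h1 := ncard_U53_le_card_U M
  have h2 := five_quarter_mul_card_U_le' (M := M) hs hpE hcol
  have h1' : ({A : Set α | A ⊆ M.E ∧ M.eRk A = ((5 : ℕ) : ℕ∞) ∧ M.eRk (M.E \ A) = ((3 : ℕ) : ℕ∞)}.ncard : ℚ) ≤
      ((U M).card : ℚ) := by exact_mod_cast h1
  calc (5 / 4 : ℚ) * _ ≤ (5 / 4 : ℚ) * ((U M).card : ℚ) := mul_le_mul_of_nonneg_left h1' (by norm_num)
    _ ≤ _ := h2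

end PercRepro
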